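import Summits.AnomalousDissipation.AnomalousDissipation.Theorems.SawtoothPulseCascadeApproxSlotStep

/-!
# One half-slot of the forced linearised response, V half-slot
(route `AnomalousDissipation/SawtoothPulseCascade`; helper for the crux ApproxSol58 =
stmt-AnomalousDissipation-19688, registered stub `stub_responseL2` / S1 `stub_responseL2Envelope`:
the realignment pipeline, the Duhamel step — vertical twin of `…ApproxSlotStep`)

On the V half-slot `[tStart j + tHalf j, tStart (j+1)]` the cascade field is the vertical shear
`rateV_j(t) U_j(x₁) e₂`; the forced response splits as `L = S + F(·, x₁) e₂` with `F` the forced parallel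
heat profile from zero driven by `ν rateV_j U_j''`, `√∫‖L − S‖² ≤ 6√(2π) ν N_j γ/δ_j`, and a homogeneous
solution started from the realigned comb profile `g(x₁) e₂` ends at `F(tStart (j+1), x₁) e₂`.
-/

set_option linter.dupNamespace false

noncomputable section

namespace Summit.AnomalousDissipation.AnomalousDissipation.Theorems.SawtoothPulseCascade.ApproxResponse

open Set MeasureTheory
open scoped ContDiff InnerProductSpace
open Literature.Analysis Literature.Analysis.FunctionSpaces Literature.Analysis.FluidPDE
open Literature.Analysis.FluidPDE.SawtoothCascade
open Literature.Analysis.FluidPDE.SawtoothCascade.CascadeParams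
open Summit.AnomalousDissipation.AnomalousDissipation.Theorems.SawtoothPulseCascade.K2Classical

/-! ## §1 The split on the V half-slot -/

/-- **Split of the forced response on the V half-slot of phase `j`.**  For `δ₀ > 0`, `d > 0`, `γ ≥ 0`,
`N_j ≠ 0`, `ν > 0`: let `(L, q)` solve the heat-lag-forced linearised equations classically on
`[0, T'] ⊇ [tStart j, tStart j + tHalf j]` and let `(S, Q)` be a classical homogeneous solution on the slot
with `L(tStart j + tHalf j) = S(tStart j + tHalf j)`.  Then `L = S + F(·, x₁) e₂` on the slot, `F` the forced parallel heat
profile from zero (`∂ₜ|_slot F = ν F'' + ν rateV_j U_j''`), and `√∫‖L(t) − S(t)‖² ≤ 6√(2π) ν N_j γ / δ_j`. -/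
theorem slot_split_V (P : CascadeParams) (hδ₀ : 0 < P.δ₀) (hd : 0 < P.d) (hγ : 0 ≤ P.γ) {j : ℕ}
    (hN : P.N j ≠ 0) {ν : ℝ} (hν : 0 < ν) {T' : ℝ} (hT' : tStart (j + 1) ≤ T')
    {L : ℝ → UnitAddTorus (Fin 2) → EuclideanSpace ℝ (Fin 2)} {q : ℝ → UnitAddTorus (Fin 2) → ℝ}
    (hL : Torus.IsSmoothSpaceTimeOn (Icc 0 T') L) (hq : Torus.IsSmoothSpaceTimeOn (Icc 0 T') q)
    (hlin : ∀ t ∈ Icc 0 T', ∀ x, Torus.timeDerivWithin (Icc 0 T') L t x + Torus.convect (P.field t) (L t) x +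
      Torus.convect (L t) (P.field t) x =
        ν • Torus.laplacian (L t) x - Torus.gradient (q t) x + ν • Torus.laplacian (P.field t) x)
    {S : ℝ → UnitAddTorus (Fin 2) → EuclideanSpace ℝ (Fin 2)} {Q : ℝ → UnitAddTorus (Fin 2) → ℝ}
    (hS : Torus.IsSmoothSpaceTimeOn (Icc (tStart j + tHalf j) (tStart (j + 1))) S)
    (hQ : Torus.IsSmoothSpaceTimeOn (Icc (tStart j + tHalf j) (tStart (j + 1))) Q)
    (hSdiv : ∀ t ∈ Icc (tStart j + tHalf j) (tStart (j + 1)), Torus.IsDivFree (S t))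
    (hSlin : ∀ t ∈ Icc (tStart j + tHalf j) (tStart (j + 1)), ∀ x,
      Torus.timeDerivWithin (Icc (tStart j + tHalf j) (tStart (j + 1))) S t x + Torus.convect (P.field t) (S t) x +
        Torus.convect (S t) (P.field t) x = ν • Torus.laplacian (S t) x - Torus.gradient (Q t) x)
    (hLdiv : ∀ t ∈ Icc 0 T', Torus.IsDivFree (L t))
    (h0 : L (tStart j + tHalf j) = S (tStart j + tHalf j)) :
    ∃ F : ℝ → ℝ → ℝ, ContDiffOn ℝ ∞ (Function.uncurry F) (Icc (tStart j + tHalf j) (tStart (j + 1)) ×ˢ univ) ∧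
      (∀ t ∈ Icc (tStart j + tHalf j) (tStart (j + 1)), Function.Periodic (F t) 1) ∧ F (tStart j + tHalf j) = (fun _ => 0) ∧
      (∀ t ∈ Icc (tStart j + tHalf j) (tStart (j + 1)), ∀ y,
        derivWithin (fun s => F s y) (Icc (tStart j + tHalf j) (tStart (j + 1))) t =
          ν * deriv (deriv (F t)) y + ν * (P.rateV j t * deriv (deriv (P.U j)) y)) ∧
      (∀ t ∈ Icc (tStart j + tHalf j) (tStart (j + 1)),
        L t = fun x => S t x + F t (Torus.repr x 0) • EuclideanSpace.single (1 : Fin 2) (1 : ℝ)) ∧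
      (∀ t ∈ Icc (tStart j + tHalf j) (tStart (j + 1)),
        Real.sqrt (Torus.vectorL2Sq (fun x => L t x - S t x)) ≤
          6 * Real.sqrt (2 * Real.pi) * ν * (P.N j) * P.γ / P.δ j) := by
  have hlt : tStart j + tHalf j < tStart (j + 1) := by rw [tStart_succ]; linarith [tHalf_pos j]
  have hδ := P.δ_pos hδ₀ hd j
  have hsub : Icc (tStart j + tHalf j) (tStart (j + 1)) ⊆ Icc 0 T' :=
    fun s hs => ⟨by linarith [tStart_nonneg j, (tHalf_pos j).le, hs.1], hs.2.trans hT'⟩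
  have hsub1 : Icc (tStart j + tHalf j) (tStart (j + 1)) ⊆ Ico (0 : ℝ) 1 :=
    fun s hs => ⟨by linarith [tStart_nonneg j, (tHalf_pos j).le, hs.1], lt_of_le_of_lt hs.2 (tStart_lt_one (j + 1))⟩
  have hfield : Torus.IsSmoothSpaceTimeOn (Icc (tStart j + tHalf j) (tStart (j + 1))) P.field :=
    (cascadeFieldSmooth P hδ₀ hd).mono hsub1
  -- the forced parallel profile from zero
  obtain ⟨F, hF, hFper, heatF, hF0⟩ := exists_heatProfile_forced hlt hν (g := fun _ : ℝ => (0 : ℝ))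
    contDiff_const (fun _ => rfl) (σ := fun t y => ν * (P.rateV j t * deriv (deriv (P.U j)) y))
    (contDiffOn_lagSource P hδ ν (P.contDiff_rateV j) _)
    (fun t _ y => by simp only [(periodic_deriv_deriv_U P j) y])
  set Φ : ℝ → UnitAddTorus (Fin 2) → EuclideanSpace ℝ (Fin 2) :=
    fun t x => F t (Torus.repr x 0) • EuclideanSpace.single (1 : Fin 2) (1 : ℝ) with hΦ_def
  have hΦs : Torus.IsSmoothSpaceTimeOn (Icc (tStart j + tHalf j) (tStart (j + 1))) Φ :=
    isSmoothSpaceTimeOn_parallelShear hF hFper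
  have hΦdiv : ∀ t ∈ Icc (tStart j + tHalf j) (tStart (j + 1)), Torus.IsDivFree (Φ t) :=
    fun t ht => isDivFree_parallelShear (k := 0) (m := 1) (by decide) (hFper t ht)
  have h0s : Torus.IsSmoothSpaceTimeOn (Icc (tStart j + tHalf j) (tStart (j + 1)))
      (fun (_ : ℝ) (_ : UnitAddTorus (Fin 2)) => (0 : ℝ)) :=
    Torus.isSmoothSpaceTimeOn_const (Torus.isSmooth_const (0 : ℝ)) _
  have hΦlin : ∀ t ∈ Icc (tStart j + tHalf j) (tStart (j + 1)), ∀ x,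
      Torus.timeDerivWithin (Icc (tStart j + tHalf j) (tStart (j + 1))) Φ t x + Torus.convect (P.field t) (Φ t) x +
        Torus.convect (Φ t) (P.field t) x =
          ν • Torus.laplacian (Φ t) x - Torus.gradient (fun _ : UnitAddTorus (Fin 2) => (0 : ℝ)) x +
            ν • Torus.laplacian (P.field t) x := by
    intro t ht x
    simp only [hΦ_def]
    rw [linearisedNSForced_parallelShear (k := 0) (m := 1) (by decide) (uniqueDiffOn_Icc hlt) (u := P.field)
      (c := fun t y => P.rateV j t * P.U j y) (fun _ hs => field_eq_parallel_V P hs)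
      (fun t _ y => by simp only [P.U_periodic j y])
      (fun _ _ => contDiff_const.mul (P.contDiff_U hδ)) hF hFper heatF t ht x,
      laplacian_field_of_mem_V P hδ₀ hd ht x, smul_smul]
  -- `L` restricted to the slot
  have hLs := hL.mono hsub
  have hqs := hq.mono hsub
  have hlin' : ∀ t ∈ Icc (tStart j + tHalf j) (tStart (j + 1)), ∀ x,
      Torus.timeDerivWithin (Icc (tStart j + tHalf j) (tStart (j + 1))) L t x + Torus.convect (P.field t) (L t) x +
        Torus.convect (L t) (P.field t) x =
          ν • Torus.laplacian (L t) x - Torus.gradient (q t) x + ν • Torus.laplacian (P.field t) x := by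
    intro t ht x
    rw [timeDerivWithin_Icc_eq_of_subset hlt hsub hL ht x]
    exact hlin t (hsub ht) x
  -- the difference `L − Φ` solves the homogeneous equations with datum `S(tStart j)`
  have hDlin : ∀ t ∈ Icc (tStart j + tHalf j) (tStart (j + 1)), ∀ x,
      Torus.timeDerivWithin (Icc (tStart j + tHalf j) (tStart (j + 1))) (fun s y => L s y - Φ s y) t x +
        Torus.convect (P.field t) (fun y => L t y - Φ t y) x + Torus.convect (fun y => L t y - Φ t y) (P.field t) x =
          ν • Torus.laplacian (fun y => L t y - Φ t y) x -
            Torus.gradient (fun y => q t y - (fun (_ : ℝ) (_ : UnitAddTorus (Fin 2)) => (0 : ℝ)) t y) x := by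
    intro t ht x
    have h := Torus.linearisedNSForced_sub_eq hLs hqs hlin' hΦs h0s hΦlin hlt ht x
    rw [sub_self, add_zero] at h
    exact h
  have hDs : Torus.IsSmoothSpaceTimeOn (Icc (tStart j + tHalf j) (tStart (j + 1))) (fun s y => L s y - Φ s y) := hLs.sub hΦs
  have hDq : Torus.IsSmoothSpaceTimeOn (Icc (tStart j + tHalf j) (tStart (j + 1)))
      (fun s y => q s y - (fun (_ : ℝ) (_ : UnitAddTorus (Fin 2)) => (0 : ℝ)) s y) := hqs.sub h0s
  have hDdiv : ∀ t ∈ Icc (tStart j + tHalf j) (tStart (j + 1)), Torus.IsDivFree (fun y => L t y - Φ t y) := by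
    intro t ht x
    have h12 : (fun y => L t y - Φ t y) = L t - Φ t := rfl
    rw [h12, Torus.divergence_sub ((hLs.isSmooth_slice ht).isContDiff (by simp))
      ((hΦs.isSmooth_slice ht).isContDiff (by simp)), hLdiv t (hsub ht) x, hΦdiv t ht x, sub_zero]
  have ha : tStart j + tHalf j ∈ Icc (tStart j + tHalf j) (tStart (j + 1)) := left_mem_Icc.2 hlt.le
  have hD0 : (fun y => L (tStart j + tHalf j) y - Φ (tStart j + tHalf j) y) = S (tStart j + tHalf j) := by
    funext y
    simp only [hΦ_def, hF0, zero_smul, sub_zero, h0]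
  have huniq : ∀ t ∈ Icc (tStart j + tHalf j) (tStart (j + 1)), (fun y => L t y - Φ t y) = S t := fun t ht =>
    Torus.linearisedNS_unique hν.le hfield (fun s hs => P.isDivFree_field_of_mem_V hs) hDs hDq hDdiv hDlin
      hS hQ hSdiv hSlin hD0 ht
  -- size of the slot part
  have hbound : ∀ t ∈ Icc (tStart j + tHalf j) (tStart (j + 1)), ∀ y,
      |F t y| ≤ 6 * Real.sqrt (2 * Real.pi) * ν * (P.N j) * P.γ / P.δ j := by
    intro t ht y
    have heat' : ∀ s ∈ Icc (tStart j + tHalf j) (tStart (j + 1)), ∀ z,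
        derivWithin (fun τ => F τ z) (Icc (tStart j + tHalf j) (tStart (j + 1))) s =
          ν * deriv (deriv (F s)) z + P.rateV j s * (ν * deriv (deriv
            (fun y : ℝ => roundedSaw (P.δ j) (2 * Real.pi * (P.N j : ℕ) * y) / (2 * Real.pi * (P.N j : ℕ)))) z) := by
      intro s hs z
      rw [heatF s hs z, cascade_U_eq]
      ring
    have h := abs_forcedProfile_le hδ hN hlt hν.le hF hFper hF0
      (P.contDiff_rateV j) heat' ht y
    rw [abs_of_pos hν] at h
    have hI : (∫ s in (tStart j + tHalf j)..t, |P.rateV j s|) ≤ P.γ := by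
      rw [← integral_abs_rateV P hγ j]
      have hend : tStart (j + 1) = tStart j + tHalf j + tHalf j := by rw [tStart_succ]; ring
      exact intervalIntegral.integral_mono_interval le_rfl ht.1 (ht.2.trans hend.le)
        (ae_of_all _ fun s => abs_nonneg _) ((P.continuous_rateV j).abs.intervalIntegrable _ _)
    have hK : 0 ≤ 6 * Real.sqrt (2 * Real.pi) * ν * (P.N j : ℝ) := by positivity
    calc |F t y| ≤ 6 * Real.sqrt (2 * Real.pi) * ν * (P.N j) * (∫ s in (tStart j + tHalf j)..t, |P.rateV j s|) / P.δ j := h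
      _ ≤ 6 * Real.sqrt (2 * Real.pi) * ν * (P.N j) * P.γ / P.δ j := by
          gcongr
  refine ⟨F, hF, hFper, hF0, heatF, fun t ht => ?_, fun t ht => ?_⟩
  · funext x
    have := congrFun (huniq t ht) x
    rw [← this]
    simp only [hΦ_def, sub_add_cancel]
  · have hEq : (fun x => L t x - S t x) = Φ t := by
      funext x
      have := congrFun (huniq t ht) x
      rw [← this]
      simp only [hΦ_def]
      abel
    rw [hEq]
    exact sqrt_vectorL2Sq_parallel_le (by positivity) (hbound t ht) 0 1

/-! ## §2 The realigned end value on the V half-slot -/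

/-- **End value on the V half-slot.**  With `F` the forced parallel profile of `slot_split_V` and `W` a
classical homogeneous solution on the slot started from the realigned comb profile `g` of
`exists_realigned_V` (`W(tStart j + tHalf j) = g(x₁) e₂`): `W(tStart (j+1)) = F(tStart (j+1), x₁) e₂`. -/
theorem slot_end_V (P : CascadeParams) (hδ₀ : 0 < P.δ₀) (hd : 0 < P.d) {j : ℕ} {ν : ℝ} (hν : 0 < ν)
    {g : ℝ → ℝ} (hg : ContDiff ℝ ∞ g) (hgper : Function.Periodic g 1)
    (hreal : ∀ c F : ℝ → ℝ → ℝ,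
        ContDiffOn ℝ ∞ (Function.uncurry c) (Icc (tStart j + tHalf j) (tStart (j + 1)) ×ˢ univ) →
        (∀ t ∈ Icc (tStart j + tHalf j) (tStart (j + 1)), Function.Periodic (c t) 1) →
        (∀ t ∈ Icc (tStart j + tHalf j) (tStart (j + 1)), ∀ y,
          derivWithin (fun s => c s y) (Icc (tStart j + tHalf j) (tStart (j + 1))) t = ν * deriv (deriv (c t)) y) →
        c (tStart j + tHalf j) = g →
        ContDiffOn ℝ ∞ (Function.uncurry F) (Icc (tStart j + tHalf j) (tStart (j + 1)) ×ˢ univ) →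
        (∀ t ∈ Icc (tStart j + tHalf j) (tStart (j + 1)), Function.Periodic (F t) 1) → F (tStart j + tHalf j) = (fun _ => 0) →
        (∀ t ∈ Icc (tStart j + tHalf j) (tStart (j + 1)), ∀ y,
          derivWithin (fun s => F s y) (Icc (tStart j + tHalf j) (tStart (j + 1))) t =
            ν * deriv (deriv (F t)) y + ν * (P.rateV j t * deriv (deriv (P.U j)) y)) →
        c (tStart (j + 1)) = F (tStart (j + 1)))
    {F : ℝ → ℝ → ℝ} (hF : ContDiffOn ℝ ∞ (Function.uncurry F) (Icc (tStart j + tHalf j) (tStart (j + 1)) ×ˢ univ))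
    (hFper : ∀ t ∈ Icc (tStart j + tHalf j) (tStart (j + 1)), Function.Periodic (F t) 1) (hF0 : F (tStart j + tHalf j) = (fun _ => 0))
    (heatF : ∀ t ∈ Icc (tStart j + tHalf j) (tStart (j + 1)), ∀ y,
      derivWithin (fun s => F s y) (Icc (tStart j + tHalf j) (tStart (j + 1))) t =
        ν * deriv (deriv (F t)) y + ν * (P.rateV j t * deriv (deriv (P.U j)) y))
    {W : ℝ → UnitAddTorus (Fin 2) → EuclideanSpace ℝ (Fin 2)} {R : ℝ → UnitAddTorus (Fin 2) → ℝ}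
    (hW : Torus.IsSmoothSpaceTimeOn (Icc (tStart j + tHalf j) (tStart (j + 1))) W)
    (hR : Torus.IsSmoothSpaceTimeOn (Icc (tStart j + tHalf j) (tStart (j + 1))) R)
    (hWdiv : ∀ t ∈ Icc (tStart j + tHalf j) (tStart (j + 1)), Torus.IsDivFree (W t))
    (hWlin : ∀ t ∈ Icc (tStart j + tHalf j) (tStart (j + 1)), ∀ x,
      Torus.timeDerivWithin (Icc (tStart j + tHalf j) (tStart (j + 1))) W t x + Torus.convect (P.field t) (W t) x +
        Torus.convect (W t) (P.field t) x = ν • Torus.laplacian (W t) x - Torus.gradient (R t) x)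
    (hW0 : W (tStart j + tHalf j) = fun x => g (Torus.repr x 0) • EuclideanSpace.single (1 : Fin 2) (1 : ℝ)) :
    W (tStart (j + 1)) =
      fun x => F (tStart (j + 1)) (Torus.repr x 0) • EuclideanSpace.single (1 : Fin 2) (1 : ℝ) := by
  have hlt : tStart j + tHalf j < tStart (j + 1) := by rw [tStart_succ]; linarith [tHalf_pos j]
  have hb : tStart (j + 1) ∈ Icc (tStart j + tHalf j) (tStart (j + 1)) := right_mem_Icc.2 hlt.le
  obtain ⟨c, hc, hcper, heatc, hca⟩ := exists_heatProfile hlt hν hg hgper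
  have hW0' : W (tStart j + tHalf j) = fun x => c (tStart j + tHalf j) (Torus.repr x 0) • EuclideanSpace.single (1 : Fin 2) (1 : ℝ) := by
    rw [hW0, hca]
  obtain ⟨heq, -⟩ := parallel_V_unique P hδ₀ hd hν.le hc hcper heatc hW hR hWdiv hWlin hW0' hb
  rw [heq, hreal c F hc hcper heatc hca hF hFper hF0 heatF]

end Summit.AnomalousDissipation.AnomalousDissipation.Theorems.SawtoothPulseCascade.ApproxResponse

end
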